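/-
Copyright: statement-level skeleton of a published paper (lit-balaban cell, Phase-2 proof seat p37). No proof claims beyond what
the kernel checks below.
-/
import Literature.MathematicalPhysics.QuantumFieldTheory.Balaban1983to89.B3Eq123Counterterms
import Literature.MathematicalPhysics.QuantumFieldTheory.Balaban1983to89.B3Eq316ResolventZeroTorus

/-!
# `Balaban1983to89.B3Eq122TorusPropagators` — T. Bałaban, *(Higgs)₂,₃ quantum fields in a finite volume. III. Renormalization*,
Commun. Math. Phys. **88** (1983) 411–445 [Balaban1983Higgs3], Sect. 1 p. 416, (1.21)/(1.22): the free propagators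
**C^ε_0 = (−Δ^ε_0 + m²)^{−1}** (scalar field) and **C^ε = (−Δ^ε + μ₀²)^{−1}** (vector field) of the self-energy expansion AS THE
RESOLVENT KERNELS OF THE TORUS LAPLACIAN, and the CONCRETE instance of the (1.22)/(1.23) data (`B3Eq123Counterterms.SEData`) they
define — with translation invariance PROVED, so that every displayed counterterm of (1.23) is a number, hypothesis-free

statement-level skeleton of published theorems with citation tags; proofs where landed; nothing here is a claim about the
Yang–Mills mass gap

PDF held: `paper:balaban1983-higgs-2-3-quantum-fields-finite-volume` (journal page = PDF page + 410).  Page 416 [PDF 6] was READ AS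
AN IMAGE on the ×2 render `run/shared/lean/pub/pub-balaban/b2b-balaban-ref1/pages/1983-cmp88-higgs23-III/1983-cmp88-higgs23-III-p006-x2.png`.

CITATION HEADER (lean-in-tree rule).  lit-balaban MEGA-FORMALIZATION (HOME `run/shared/lean/pub/lit-balaban/`), Phase 2, seat
**p37 gen 104** (unit `lit-balaban-p37-g104`), free-target protocol G.5-34(d) (TAKING HOME/STATUS.md 2026-08-23T07:26:26Z), the
target NAMED by the lead g11 in the HEAD WORD Q19 (HOME/STATUS.md 2026-08-23T07:11:26Z): *"A CONCRETE `SEData` instance built from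
the torus resolvent kernels with `ShiftInv` proved for them is WELCOME as a located member of B3.Eq1.23 ∕ B3.Eq1.19-1.22 (zero head
weight; it would make the two cells self-contained)"* (= `HOME/lit-balaban-r15/B3-CLOSURE.md` §5 item 19 «FREE TARGET»).
WHAT IS REPRODUCED: rows **B3.Eq1.19-1.22** (the (1.21)/(1.22) cell: the propagators) and **B3.Eq1.23** (x-independence of the
counterterms) of `HOME/lit-balaban-r15/ROWS-B3.md` (fold owner r15) — a LOCATED MEMBER; no head question is raised by this file.

THE PRINTED TEXT.  p. 416 [PDF 6], verbatim: *"G^ε = Σ_{n=0}^∞ C^ε_0[(−δm² + Σ^ε + ∂^{ε*}Σ^ε_1 + Σ^{ε*}_1∂^ε + ∂^{ε*}Σ^ε_2∂^ε)C^ε_0]^n,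
(1.21) where C^ε_0 = (−Δ^ε_0 + m²)^{−1} and Σ^ε, Σ^ε_1, Σ^ε_2 are given by amputated, one-particle-irreducible graphs of the expansion of
G^ε. … We have η = ε (hence L^kε = 1) … The propagators are C^ε_0 for the scalar field and C^ε = (−Δ^ε + μ₀²)^{−1} for the vector
field (of course internal indices and vector indices are understood here)."*; the action (1.20) on the same page carries
*"½⟨φ,(−Δ^ε_A + m²)φ⟩"* and *"½⟨A,(−Δ^ε + μ₀²)A⟩"*.  OUR READING (the subscript 0 is not defined in print; it is forced by
(1.22)'s *"C^ε_0(x − x′)"*, a function of the difference): Δ^ε_0 is the covariant Laplacian Δ^ε_A of (1.20) at the expansion point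
A = 0, i.e. the Laplace operator Δ^ε of the torus T_ε acting componentwise ([Balaban1982Higgs1] p. 605: *"−Δ^ε_A = D^{ε*}_AD^ε_A is
the covariant Laplace operator and −Δ^ε = ∂^{ε*}∂^ε is the Laplace operator on the torus T_ε"*; D^ε_A = ∂^ε at A = 0).  With the
internal/vector indices understood (the tree's convention T1 of `B3Eq131Example`/`B3Eq123Counterterms`: identity in the indices,
kernels real-valued) BOTH propagators are therefore resolvent kernels (−Δ^ε + M)^{−1}(x, x′) of ONE operator, the torus Laplacian
−Δ^ε = r05's `B1RG242Torus.hOp P j ε 0`, at the two masses M = m² and M = μ₀².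

WHAT IS DEFINED AND PROVED (everything kernel-checked; `s` a lattice spacing, `T^{(j)}` = `Site P j`; −Δ^s + M = r05's matrix
`B1RG242Torus.hOp P j s M` = M·1 + Σ_μ(∂^s_μ)ᵀ∂^s_μ, which acts as M + r15's `LatticeFieldCalculus.laplace s⁻¹` (p39's
`B3Eq316ResolventZeroTorus.hOp_mulVec_eq_laplace`)).
* §1 THE RESOLVENT KERNEL **`resKernel P j s M x x′ := s^{−d}·((−Δ^s + M)^{−1})_{x x′}`** — the kernel of (−Δ^s + M)^{−1} for the
  volume element s^d of the sums Σ_{x′∈T} s^d (r15's `kernelOp`), M > 0: invertibility of −Δ^s + M (`hOp_mulVec_injective`,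
  `isUnit_hOp`: the form is ≥ M‖f‖²), the dictionary `kernelOp_resKernel` ((Cf)(x) = Σ_{x′}s^dC(x,x′)f(x′) = ((−Δ^s + M)^{−1}f)(x)),
  **the Green's-function equations** `hOp_mulVec_kernelOp_resKernel` ((−Δ^s + M)(Cf) = f), `laplace_kernelOp_resKernel_add` (the same
  in the `laplace` vocabulary, the shape of p03's `laplace_kernelOp_CxiT_add`), `kernelOp_resKernel_hOp_mulVec` (C((−Δ^s + M)g) = g),
  the column equation `laplace_resKernel_add` ((−Δ^s + M)C(·,x′) = s^{−d}δ_{x′}) and uniqueness `eq_kernelOp_resKernel`; **symmetry**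
  `resKernel_symm`; **TRANSLATION INVARIANCE `shiftInv_resKernel`** (p26's `ShiftInv`: C(x + e_μ, x′ + e_μ) = C(x, x′) — because −Δ^s
  commutes with the unit translations of the torus, `laplace_col_shift`/`hOp_mulVec_col_shift`, and the Green's function is unique),
  hence the diagonal C(x,x) =: `diag` is ONE number (`resKernel_diag_const`, print's "C^ε_0(0)", "C^ε(0)"), and it is > 0
  (`resKernel_diag_pos`); the unit-mass identity Σ_{x′}s^dC(x,x′) = M^{−1} (`sum_mul_resKernel`: (−Δ^s + M)^{−1}1 = M^{−1}).
* §2 THE BRIDGE TO p03's TORUS PROPAGATOR `B3CxiTorusBound.CxiT` (C^ξ_T = (−Δ^ξ + 1)^{−1}, built by periodization of the ξℤ^d kernel):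
  `hOp_eq_smul_unitMass` (−Δ^s + m² = m²·(−Δ^{ms} + 1), r02's `B5Display136Torus.hOp_rescale`), `inv_hOp_unitMass`
  ((−Δ^ξ + 1)^{−1} = ξ^d·C^ξ_T as matrices, from p39's `hOp_mul_CxiT`), and **`resKernel_eq_CxiT`: C^s_{m²}(x,x′) = m^{d−2}·C^{ms}_T(x,x′)**
  (uniqueness of the inverse) — whence `resKernel_nonneg` (C ≥ 0) and, in d = 3, p03's printed decay bound transported:
  `abs_resKernel_le` (|C^s_{m²}(x,x′)| ≤ m·A_T(ms|x−x′|_∞)^{−1}e^{−½ms|x−x′|_∞} for ms ≤ 1 ≤ ms·N).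
* §3 **THE CONCRETE (1.22) DATA ON THE TORUS** `torusSEData P j ε e λ N q2 m² μ₀²` : p26's `SEData P j` with
  C^ε_0 := `resKernel P j ε m²`, C^ε := `resKernel P j ε μ₀²` (the printed lattice T_ε is j = 0, ε = `P.eps`: `printedSEData`), and,
  HYPOTHESIS-FREE at this instance (m², μ₀² > 0): `shiftInv_torus_C0`/`shiftInv_torus_C`; **`torus_ct_const`, `torus_dm2One_const`,
  `torus_dm2_123_const`** — p26's §6 theorems `ct_const`/`dm2One_const`/`dm2_123_const` with their `ShiftInv` hypotheses DISCHARGED: every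
  displayed counterterm ①–⑦ of (1.23), δm²₁ and the displayed δm² are constants on T_ε, as print's δm² is a number; the closed forms
  of ①②③ with the two constants C^ε_0(0) = `diag ε m²`, C^ε(0) = `diag ε μ₀²` (`torus_ct1_eq`, `torus_ct2_eq`, `torus_ct3_eq`); and the
  propagator equations for the instance's own fields (`torus_C0_green`, `torus_C_green`: C^ε_0 = (−Δ^ε + m²)^{−1}, C^ε = (−Δ^ε + μ₀²)^{−1}
  as operators for the ε^d-weighted sums).
HONEST SCOPE.  Internal and vector indices = identity (T1, as print: *"understood here"*); masses m², μ₀² > 0 (print's m², μ₀² are the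
bare positive masses of (1.20)); all d, all levels j, every spacing ε > 0 (resp. ε ≠ 0 where only that is used); the d = 3 decay bound
carries p03's hypotheses ms ≤ 1 ≤ ms·N verbatim.  Nothing is asserted about Σ^ε beyond p26's displayed part, about 1PI-ness, or about
the ε → 0 behaviour of C^ε_0(0), C^ε(0) (p26's `B3Eq122LocalDivergence` lane on ξℤ^d).  Mathlib + the cited tree files only; TWO
definitions with bodies (`resKernel`, `torusSEData`) + two abbreviations (`diag`, `printedSEData`); 0 sorry, 0 new `Prop` facts;
axioms standard.  Unit `lit-balaban-p37` gen 104 (literature-prover-lit-balaban-p37-g104-0), 2026-08-23.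
-/

open scoped BigOperators

namespace Literature.MathematicalPhysics.QuantumFieldTheory.Balaban1983to89.B3Eq122TorusPropagators

open Matrix B1RG242Torus LatticeFieldCalculus B3Sect3ScalarSelfEnergy B3CxiTorusBound B3Eq316ResolventZeroTorus
  B3Eq123Counterterms B3Sect1TwoPoint B3TorusRadialSums

noncomputable section

variable {P : Params} {j : ℕ}

/-! ## §0 Kernel lemmas: unit translations of the torus -/

section Shifts

/-- kernel: unit translations commute. [folklore] -/
private theorem shift_comm' (x : Site P j) (μ ν : Fin P.d) : (x.shift μ).shift ν = (x.shift ν).shift μ := by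
  funext κ
  unfold Site.shift
  rcases eq_or_ne κ ν with rfl | h1
  · rcases eq_or_ne κ μ with rfl | h2
    · simp only [Function.update_self]
    · simp only [Function.update_self, Function.update_of_ne h2]
  · rcases eq_or_ne κ μ with rfl | h2
    · simp only [Function.update_self, Function.update_of_ne h1]
    · simp only [Function.update_of_ne h1, Function.update_of_ne h2]

/-- kernel: a forward and a backward unit translation commute. [folklore] -/
private theorem shift_unshift_comm' (x : Site P j) (μ ν : Fin P.d) : (x.unshift ν).shift μ = (x.shift μ).unshift ν := by
  funext κ
  unfold Site.shift Site.unshift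
  rcases eq_or_ne κ μ with rfl | h1
  · rcases eq_or_ne κ ν with rfl | h2
    · simp only [Function.update_self]; ring
    · simp only [Function.update_self, Function.update_of_ne h2]
  · rcases eq_or_ne κ ν with rfl | h2
    · simp only [Function.update_self, Function.update_of_ne h1]
    · simp only [Function.update_of_ne h1, Function.update_of_ne h2]

/-- kernel: `x ↦ x + e_μ` is injective. [folklore] -/
private theorem shift_injective' (μ : Fin P.d) : Function.Injective fun x : Site P j => x.shift μ :=
  (shiftEquiv (P := P) (j := j) μ).injective

/-- kernel: the x-entry of `A` applied to the x′-column of `B` is the (x,x′) entry of `A·B`. [folklore] -/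
private theorem mulVec_col (A B : Matrix (Site P j) (Site P j) ℝ) (x x' : Site P j) :
    (A *ᵥ fun a => B a x') x = (A * B) x x' := by
  simp only [Matrix.mulVec, dotProduct, Matrix.mul_apply]

/-- kernel: a constant factor comes out of the lattice Laplacian. [folklore] -/
private theorem laplace_const_mul' (c a : ℝ) (g : SiteField P j ℝ) (x : Site P j) :
    laplace c (fun y => a * g y) x = a * laplace c g x := by
  simp only [laplace, smul_eq_mul, Finset.mul_sum]
  exact Finset.sum_congr rfl fun μ _ => by ring

end Shifts

/-! ## §1 The resolvent (−Δ^s + M)^{−1} of the torus Laplacian as a two-point kernel -/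

section Resolvent

/-- **−Δ^s commutes with the unit translations** (on site functions): translating the argument and applying r15's lattice
Laplacian is applying it and translating. [cite: Balaban1982Higgs1, (1.11) p.605] -/
theorem laplace_translate (c : ℝ) (f : SiteField P j ℝ) (μ : Fin P.d) (x : Site P j) :
    laplace c (fun y => f (y.shift μ)) x = laplace c f (x.shift μ) := by
  simp only [laplace, smul_eq_mul]
  refine Finset.sum_congr rfl fun ν _ => ?_
  rw [shift_comm' x ν μ, shift_unshift_comm' x μ ν]

/-- The same on the columns of a two-point kernel: −Δ^s_x K(x + e_μ, x′) = (−Δ^sK(·, x′))(x + e_μ). [cite: Balaban1982Higgs1, (1.11) p.605] -/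
theorem laplace_col_shift (c : ℝ) (K : Kernel P j) (μ : Fin P.d) (x x' : Site P j) :
    laplace c (fun y => K (y.shift μ) x') x = laplace c (fun y => K y x') (x.shift μ) := by
  simp only [laplace, smul_eq_mul]
  refine Finset.sum_congr rfl fun ν _ => ?_
  rw [shift_comm' x ν μ, shift_unshift_comm' x μ ν]

/-- **−Δ^s + M commutes with the unit translations** (the tower's matrix `hOp`, on columns of a kernel).
[cite: Balaban1982Higgs1, (1.11) p.605] -/
theorem hOp_mulVec_col_shift (s M : ℝ) (K : Kernel P j) (μ : Fin P.d) (x' : Site P j) :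
    (hOp P j s M *ᵥ fun y => K (y.shift μ) x') = fun x => (hOp P j s M *ᵥ fun y => K y x') (x.shift μ) := by
  funext x
  rw [hOp_mulVec_eq_laplace, hOp_mulVec_eq_laplace, laplace_col_shift]

/-- **−Δ^s + M is injective for M > 0**: its quadratic form is M‖f‖² + Σ_μ‖∂_μf‖² ≥ M‖f‖² (r05's `form_hOp`).
[cite: Balaban1983Higgs3, (1.21) p.416] -/
theorem hOp_mulVec_injective (s : ℝ) {M : ℝ} (hM : 0 < M) : Function.Injective (hOp P j s M).mulVec := by
  intro f g h
  have h0 : hOp P j s M *ᵥ (f - g) = 0 := by rw [Matrix.mulVec_sub, h, sub_self]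
  have hform := form_hOp (P := P) s M (f - g)
  rw [h0, dotProduct_zero] at hform
  have h1 : 0 ≤ ∑ μ, (deriv P j s μ *ᵥ (f - g)) ⬝ᵥ (deriv P j s μ *ᵥ (f - g)) :=
    Finset.sum_nonneg fun μ _ => Finset.sum_nonneg fun x _ => mul_self_nonneg _
  have h2 : 0 ≤ (f - g) ⬝ᵥ (f - g) := Finset.sum_nonneg fun x _ => mul_self_nonneg _
  have h3 : 0 ≤ M * ((f - g) ⬝ᵥ (f - g)) := mul_nonneg hM.le h2
  have h4 : M * ((f - g) ⬝ᵥ (f - g)) = 0 := by linarith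
  have h5 : (f - g) ⬝ᵥ (f - g) = 0 := (mul_eq_zero.mp h4).resolve_left hM.ne'
  exact sub_eq_zero.mp (dotProduct_self_eq_zero.mp h5)

/-- **(−Δ^s + M) is invertible for M > 0** — the resolvents C^ε_0 = (−Δ^ε_0 + m²)^{−1}, C^ε = (−Δ^ε + μ₀²)^{−1} of p. 416 exist on
the torus. [cite: Balaban1983Higgs3, (1.21) p.416] -/
theorem isUnit_hOp (s : ℝ) {M : ℝ} (hM : 0 < M) : IsUnit (hOp P j s M) :=
  Matrix.mulVec_injective_iff_isUnit.mp (hOp_mulVec_injective s hM)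

/-- the determinant form of the invertibility. [cite: Balaban1983Higgs3, (1.21) p.416] -/
theorem isUnit_hOp_det (s : ℝ) {M : ℝ} (hM : 0 < M) : IsUnit (hOp P j s M).det :=
  (Matrix.isUnit_iff_isUnit_det _).mp (isUnit_hOp s hM)

/-- (−Δ^s + M)·(−Δ^s + M)^{−1} = 1. [cite: Balaban1983Higgs3, (1.21) p.416] -/
theorem hOp_mul_inv (s : ℝ) {M : ℝ} (hM : 0 < M) : hOp P j s M * (hOp P j s M)⁻¹ = 1 :=
  Matrix.mul_nonsing_inv _ (isUnit_hOp_det s hM)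

/-- (−Δ^s + M)^{−1}·(−Δ^s + M) = 1. [cite: Balaban1983Higgs3, (1.21) p.416] -/
theorem inv_mul_hOp (s : ℝ) {M : ℝ} (hM : 0 < M) : (hOp P j s M)⁻¹ * hOp P j s M = 1 :=
  Matrix.nonsing_inv_mul _ (isUnit_hOp_det s hM)

variable (P j)

/-- **THE RESOLVENT KERNEL C^s_M(x, x′) := s^{−d}·((−Δ^s + M)^{−1})_{x x′}** — the kernel of (−Δ^s + M)^{−1} with respect to the
volume element s^d of the sums Σ_{x′∈T} s^d (so that (Cf)(x) = Σ_{x′}s^dC(x,x′)f(x′), r15's `kernelOp`): print's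
*"C^ε_0 = (−Δ^ε_0 + m²)^{−1}"* (M = m²) and *"C^ε = (−Δ^ε + μ₀²)^{−1}"* (M = μ₀²) on the torus, indices understood.
[cite: Balaban1983Higgs3, (1.21) p.416] -/
def resKernel (s M : ℝ) : Kernel P j := fun x x' => (s ^ P.d)⁻¹ * (hOp P j s M)⁻¹ x x'

/-- the diagonal value C(0) := C^s_M(x, x) at the origin (by `resKernel_diag_const` the same at every x): print's constants
"C^ε_0(0)", "C^ε(0)" of (1.22). [cite: Balaban1983Higgs3, (1.22) p.416] -/
abbrev diag (s M : ℝ) : ℝ := resKernel P j s M default default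

variable {P j}

/-- **dictionary**: the integral operator of the kernel C^s_M for the volume element s^d IS the inverse matrix,
Σ_{x′}s^dC^s_M(x,x′)f(x′) = ((−Δ^s + M)^{−1}f)(x). [cite: Balaban1983Higgs3, (1.21) p.416] -/
theorem kernelOp_resKernel {s : ℝ} (hs : s ≠ 0) (M : ℝ) (f : SiteField P j ℝ) :
    kernelOp (s ^ P.d) (resKernel P j s M) f = (hOp P j s M)⁻¹ *ᵥ f := by
  funext x
  simp only [kernelOp, resKernel, Matrix.mulVec, dotProduct]
  refine Finset.sum_congr rfl fun x' _ => ?_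
  rw [← mul_assoc (s ^ P.d), mul_inv_cancel₀ (pow_ne_zero _ hs), one_mul]

/-- **C^s_M = (−Δ^s + M)^{−1} as an operator**: (−Δ^s + M)(Cf) = f for every f. [cite: Balaban1983Higgs3, (1.21) p.416] -/
theorem hOp_mulVec_kernelOp_resKernel {s : ℝ} (hs : s ≠ 0) {M : ℝ} (hM : 0 < M) (f : SiteField P j ℝ) :
    hOp P j s M *ᵥ kernelOp (s ^ P.d) (resKernel P j s M) f = f := by
  rw [kernelOp_resKernel hs, Matrix.mulVec_mulVec, hOp_mul_inv s hM, Matrix.one_mulVec]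

/-- The same in r15's vocabulary: (−Δ^s)(Cf) + M·Cf = f (`laplace s⁻¹` = −Δ^s) — the shape of p03's `laplace_kernelOp_CxiT_add`
at a general mass. [cite: Balaban1983Higgs3, (1.21) p.416] -/
theorem laplace_kernelOp_resKernel_add {s : ℝ} (hs : s ≠ 0) {M : ℝ} (hM : 0 < M) (f : SiteField P j ℝ) :
    laplace s⁻¹ (kernelOp (s ^ P.d) (resKernel P j s M) f) + M • kernelOp (s ^ P.d) (resKernel P j s M) f = f := by
  have h := hOp_mulVec_kernelOp_resKernel hs hM f
  funext x
  have hx := congr_fun h x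
  rw [hOp_mulVec_eq_laplace] at hx
  rw [Pi.add_apply, Pi.smul_apply, smul_eq_mul, add_comm]
  exact hx

/-- **… and on the other side**: C((−Δ^s + M)g) = g for every g. [cite: Balaban1983Higgs3, (1.21) p.416] -/
theorem kernelOp_resKernel_hOp_mulVec {s : ℝ} (hs : s ≠ 0) {M : ℝ} (hM : 0 < M) (g : SiteField P j ℝ) :
    kernelOp (s ^ P.d) (resKernel P j s M) (hOp P j s M *ᵥ g) = g := by
  rw [kernelOp_resKernel hs, Matrix.mulVec_mulVec, inv_mul_hOp s hM, Matrix.one_mulVec]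

/-- **uniqueness**: the only solution of (−Δ^s + M)g = f is g = Cf. [cite: Balaban1983Higgs3, (1.21) p.416] -/
theorem eq_kernelOp_resKernel {s : ℝ} (hs : s ≠ 0) {M : ℝ} (hM : 0 < M) {f g : SiteField P j ℝ}
    (h : hOp P j s M *ᵥ g = f) : g = kernelOp (s ^ P.d) (resKernel P j s M) f := by
  rw [← h, kernelOp_resKernel_hOp_mulVec hs hM]

/-- the x′-column of the inverse matrix solves (−Δ^s + M)g = δ_{x′}. [cite: Balaban1983Higgs3, (1.21) p.416] -/
theorem hOp_mulVec_inv_col (s : ℝ) {M : ℝ} (hM : 0 < M) (x' : Site P j) :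
    (hOp P j s M *ᵥ fun y => (hOp P j s M)⁻¹ y x') = fun x => if x = x' then 1 else 0 := by
  funext x
  rw [mulVec_col, hOp_mul_inv s hM, Matrix.one_apply]

/-- **the column equation of the Green's function**: (−Δ^s)_xC^s_M(x, x′) + M·C^s_M(x, x′) = s^{−d}δ_{x x′} (the shape of p03's
`laplace_CxiT_add`). [cite: Balaban1983Higgs3, (1.21) p.416] -/
theorem laplace_resKernel_add (s : ℝ) {M : ℝ} (hM : 0 < M) (x x' : Site P j) :
    laplace s⁻¹ (fun y => resKernel P j s M y x') x + M * resKernel P j s M x x' =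
      if x = x' then (s ^ P.d)⁻¹ else 0 := by
  have h := congr_fun (hOp_mulVec_inv_col (P := P) (j := j) s hM x') x
  rw [hOp_mulVec_eq_laplace] at h
  simp only [resKernel]
  rw [laplace_const_mul']
  have e : (s ^ P.d)⁻¹ * laplace s⁻¹ (fun y => (hOp P j s M)⁻¹ y x') x + M * ((s ^ P.d)⁻¹ * (hOp P j s M)⁻¹ x x') =
      (s ^ P.d)⁻¹ * (M * (hOp P j s M)⁻¹ x x' + laplace s⁻¹ (fun y => (hOp P j s M)⁻¹ y x') x) := by ring
  rw [e, h]
  split_ifs <;> simp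

/-- **symmetry** C^s_M(x, x′) = C^s_M(x′, x): −Δ^s + M is a symmetric matrix (p38's `B4Ineq115Torus.hOp_isSymm`), hence so is its
inverse. [cite: Balaban1983Higgs3, (1.21) p.416] -/
theorem resKernel_symm (s M : ℝ) (x x' : Site P j) : resKernel P j s M x x' = resKernel P j s M x' x := by
  have hT : ((hOp P j s M)⁻¹)ᵀ = (hOp P j s M)⁻¹ := by
    rw [Matrix.transpose_nonsing_inv, (B4Ineq115Torus.hOp_isSymm P j s M).eq]
  have h := congr_fun (congr_fun hT x) x'
  rw [Matrix.transpose_apply] at h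
  simp only [resKernel, h]

/-- **TRANSLATION INVARIANCE: C^s_M(x + e_μ, x′ + e_μ) = C^s_M(x, x′)** — print's "C^ε_0(x − x′)", "C^ε(x − x′)" (p26's `ShiftInv`):
the translated column y ↦ ((−Δ^s + M)^{−1})_{y+e_μ, x′+e_μ} solves the same equation (−Δ^s + M)g = δ_{x′} as the x′-column, because
−Δ^s + M commutes with the translation, and the solution is unique. [cite: Balaban1983Higgs3, (1.22) p.416] -/
theorem shiftInv_resKernel (s : ℝ) {M : ℝ} (hM : 0 < M) : ShiftInv (resKernel P j s M) := by
  intro μ x x'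
  have key : (fun y => (hOp P j s M)⁻¹ (y.shift μ) (x'.shift μ)) = fun y => (hOp P j s M)⁻¹ y x' := by
    apply hOp_mulVec_injective s hM
    rw [hOp_mulVec_col_shift s M (fun a b => (hOp P j s M)⁻¹ a b) μ (x'.shift μ)]
    funext y
    rw [mulVec_col, mulVec_col, hOp_mul_inv s hM, Matrix.one_apply, Matrix.one_apply]
    simp only [(shift_injective' μ).eq_iff]
  have h := congr_fun key x
  simp only [resKernel, h]

/-- **the diagonal is one number**: C^s_M(x, x) = C^s_M(y, y) for all x, y — print's constants C^ε_0(0), C^ε(0) (a shift-invariant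
function on the torus is constant, r05's `Site.const_of_shift_invariant`). [cite: Balaban1983Higgs3, (1.22) p.416] -/
theorem resKernel_diag_const (s : ℝ) {M : ℝ} (hM : 0 < M) (x y : Site P j) :
    resKernel P j s M x x = resKernel P j s M y y :=
  Site.const_of_shift_invariant (fun z => resKernel P j s M z z) (fun μ z => shiftInv_resKernel s hM μ z z) x y

/-- hence C^s_M(x, x) = `diag` at every site. [cite: Balaban1983Higgs3, (1.22) p.416] -/
theorem resKernel_diag_eq (s : ℝ) {M : ℝ} (hM : 0 < M) (x : Site P j) : resKernel P j s M x x = diag P j s M :=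
  resKernel_diag_const s hM x default

/-- **C(0) > 0**: the diagonal of the inverse of the positive definite −Δ^s + M is positive (the x-column v of the inverse has
(−Δ^s + M)v = δ_x, so v(x) = ⟨v, (−Δ^s + M)v⟩ ≥ M‖v‖² > 0). [cite: Balaban1983Higgs3, (1.22) p.416] -/
theorem resKernel_diag_pos {s : ℝ} (hs : 0 < s) {M : ℝ} (hM : 0 < M) (x : Site P j) : 0 < resKernel P j s M x x := by
  simp only [resKernel]
  refine mul_pos (inv_pos.mpr (pow_pos hs _)) ?_
  set v : Site P j → ℝ := fun y => (hOp P j s M)⁻¹ y x with hv_def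
  have hv : hOp P j s M *ᵥ v = fun y => if y = x then 1 else 0 := hOp_mulVec_inv_col s hM x
  have hvx : v ⬝ᵥ (hOp P j s M *ᵥ v) = v x := by
    rw [hv]
    simp only [dotProduct, mul_ite, mul_one, mul_zero, Finset.sum_ite_eq', Finset.mem_univ, if_true]
  have hform := form_hOp (P := P) s M v
  have hne : v ⬝ᵥ v ≠ 0 := by
    intro h0
    have hv0 : v = 0 := dotProduct_self_eq_zero.mp h0
    have := congr_fun hv x
    rw [hv0, Matrix.mulVec_zero] at this
    simp at this
  have h2 : 0 ≤ v ⬝ᵥ v := Finset.sum_nonneg fun y _ => mul_self_nonneg _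
  have hpos : 0 < v ⬝ᵥ v := lt_of_le_of_ne h2 (Ne.symm hne)
  have h1 : 0 ≤ ∑ μ, (deriv P j s μ *ᵥ v) ⬝ᵥ (deriv P j s μ *ᵥ v) :=
    Finset.sum_nonneg fun μ _ => Finset.sum_nonneg fun y _ => mul_self_nonneg _
  have : v x = M * (v ⬝ᵥ v) + ∑ μ, (deriv P j s μ *ᵥ v) ⬝ᵥ (deriv P j s μ *ᵥ v) := by rw [← hvx, hform]
  show 0 < v x
  rw [this]
  exact add_pos_of_pos_of_nonneg (mul_pos hM hpos) h1

/-- hence `diag` > 0. [cite: Balaban1983Higgs3, (1.22) p.416] -/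
theorem diag_pos {s : ℝ} (hs : 0 < s) {M : ℝ} (hM : 0 < M) : 0 < diag P j s M := resKernel_diag_pos hs hM default

/-- −Δ^s + M applied to a constant is M times the constant (differences of constants vanish).
[cite: Balaban1982Higgs1, (1.11) p.605] -/
theorem hOp_mulVec_const (s M c : ℝ) : (hOp P j s M *ᵥ fun _ => c) = fun _ => M * c := by
  funext y
  rw [hOp_mulVec_eq_laplace]
  simp [laplace]

/-- **unit mass**: Σ_{x′∈T} s^d C^s_M(x, x′) = M^{−1}, i.e. (−Δ^s + M)^{−1}1 = M^{−1}·1 (cf. p03's `sum_mul_CxiT` at M = 1).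
[cite: Balaban1983Higgs3, (1.21) p.416] -/
theorem sum_mul_resKernel {s : ℝ} (hs : s ≠ 0) {M : ℝ} (hM : 0 < M) (x : Site P j) :
    ∑ x' : Site P j, s ^ P.d * resKernel P j s M x x' = M⁻¹ := by
  have h1 : (hOp P j s M *ᵥ fun _ => M⁻¹) = fun _ => (1 : ℝ) := by
    rw [hOp_mulVec_const, mul_inv_cancel₀ hM.ne']
  have h2 : kernelOp (s ^ P.d) (resKernel P j s M) (fun _ => (1 : ℝ)) = fun _ => M⁻¹ := by
    rw [kernelOp_resKernel hs, ← h1, Matrix.mulVec_mulVec, inv_mul_hOp s hM, Matrix.one_mulVec]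
  have h3 := congr_fun h2 x
  simpa only [kernelOp, mul_one] using h3

end Resolvent

/-! ## §2 The bridge to the periodized propagator `CxiT` of `B3CxiTorusBound` -/

section Bridge

/-- **−Δ^ε + m² = m²·(−Δ^{mε} + 1)** on the same torus (r02's rescaling `B5Display136Torus.hOp_rescale` for the pure resolvent):
a massive resolvent is a unit-mass resolvent at the rescaled spacing ξ = mε. [cite: Balaban1983Higgs3, (1.21) p.416] -/
theorem hOp_eq_smul_unitMass (ε : ℝ) {m : ℝ} (hm : m ≠ 0) : hOp P j ε (m ^ 2) = m ^ 2 • hOp P j (m * ε) 1 := by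
  have h := B5Display136Torus.hOp_rescale P (i := j) (m * ε) m 1
  rw [mul_div_cancel_left₀ ε hm, mul_one] at h
  exact h

/-- **(−Δ^ξ + 1)^{−1} = ξ^d·C^ξ_T as matrices**: p03's periodized propagator IS the inverse (p39's `hOp_mul_CxiT` and uniqueness of the
matrix inverse). [cite: Balaban1983Higgs3, (3.16) p.437] -/
theorem inv_hOp_unitMass {ξ : ℝ} (hξ : 0 < ξ) :
    (hOp P j ξ 1)⁻¹ = ξ ^ P.d • Matrix.of (CxiT (P := P) (j := j) ξ) := by
  apply Matrix.inv_eq_right_inv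
  rw [Matrix.mul_smul, hOp_mul_CxiT hξ, smul_smul, mul_inv_cancel₀ (pow_ne_zero _ hξ.ne'), one_smul]

/-- the inverse of the massive operator through the unit-mass one: (−Δ^ε + m²)^{−1} = m^{−2}·(−Δ^{mε} + 1)^{−1}.
[cite: Balaban1983Higgs3, (1.21) p.416] -/
theorem inv_hOp_eq_smul_unitMass (ε : ℝ) {m : ℝ} (hm : m ≠ 0) :
    (hOp P j ε (m ^ 2))⁻¹ = (m ^ 2)⁻¹ • (hOp P j (m * ε) 1)⁻¹ := by
  rw [hOp_eq_smul_unitMass ε hm]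
  refine Matrix.inv_eq_left_inv ?_
  rw [Matrix.smul_mul, Matrix.mul_smul, smul_smul, inv_mul_cancel₀ (pow_ne_zero 2 hm), one_smul,
    inv_mul_hOp (m * ε) one_pos]

/-- **THE BRIDGE: C^ε_{m²}(x, x′) = m^{d−2}·C^{mε}_T(x, x′)** — the resolvent kernel of this file at mass m² and spacing ε is p03's
periodized torus propagator at spacing ξ = mε, times m^d/m² (d powers from the volume elements ε^d vs ξ^d, −2 from the mass).
[cite: Balaban1983Higgs3, (1.21) p.416] -/
theorem resKernel_eq_CxiT {ε m : ℝ} (hε : 0 < ε) (hm : 0 < m) (x x' : Site P j) :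
    resKernel P j ε (m ^ 2) x x' = m ^ P.d / m ^ 2 * CxiT (m * ε) x x' := by
  have hε0 : ε ≠ 0 := hε.ne'
  have hm0 : m ≠ 0 := hm.ne'
  simp only [resKernel, inv_hOp_eq_smul_unitMass ε hm0, inv_hOp_unitMass (mul_pos hm hε), Matrix.smul_apply,
    Matrix.of_apply, smul_eq_mul, mul_pow]
  field_simp

/-- **C ≥ 0**: the resolvent kernel is entrywise nonnegative (p03's `CxiT_nonneg` through the bridge).
[cite: Balaban1983Higgs3, (1.21) p.416] -/
theorem resKernel_nonneg {ε : ℝ} (hε : 0 < ε) {M : ℝ} (hM : 0 < M) (x x' : Site P j) : 0 ≤ resKernel P j ε M x x' := by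
  have hm : 0 < Real.sqrt M := Real.sqrt_pos.mpr hM
  have h := resKernel_eq_CxiT (P := P) (j := j) hε hm x x'
  rw [Real.sq_sqrt hM.le] at h
  rw [h]
  exact mul_nonneg (div_nonneg (pow_nonneg hm.le _) hM.le) (CxiT_nonneg (mul_pos hm hε) _ _)

/-- **p03's printed decay bound transported (d = 3)**: |C^ε_{m²}(x, x′)| ≤ m·A_T·(mε|x − x′|_∞)^{−1}·e^{−½mε|x − x′|_∞} for x′ ≠ x,
mε ≤ 1 and physical period mε·N ≥ 1 (`B3CxiTorusBound.abs_CxiT_le`, [Balaban1983Higgs3] p. 437 *"|C^ξ(y − y′)| ≦ O(1)e^{−½|y−y′|}/|y − y′|"*).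
[cite: Balaban1983Higgs3, (3.16) p.437] -/
theorem abs_resKernel_le (hd : P.d = 3) {ε m : ℝ} (hε : 0 < ε) (hm : 0 < m) (h1 : m * ε ≤ 1)
    (hN : 1 ≤ m * ε * (P.sitesPerDir j : ℝ)) {x x' : Site P j} (hne : x' ≠ x) :
    |resKernel P j ε (m ^ 2) x x'| ≤
      m * torusConst * (m * ε * (supDist x x' : ℝ))⁻¹ * Real.exp (-(1 / 2 * (m * ε * (supDist x x' : ℝ)))) := by
  have hmε : 0 < m * ε := mul_pos hm hε
  have hb := abs_CxiT_le hd hmε h1 hN hne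
  have hc : m ^ P.d / m ^ 2 = m := by
    rw [hd]; field_simp
  rw [resKernel_eq_CxiT hε hm, hc, abs_mul, abs_of_pos hm]
  calc m * |CxiT (m * ε) x x'|
      ≤ m * (torusConst * (m * ε * (supDist x x' : ℝ))⁻¹ * Real.exp (-(1 / 2 * (m * ε * (supDist x x' : ℝ))))) :=
        mul_le_mul_of_nonneg_left hb hm.le
    _ = _ := by ring

end Bridge

/-! ## §3 The concrete (1.22)/(1.23) data on the torus and the counterterms as numbers -/

section Instance

variable (P j)

/-- **THE (1.22) DATA ON THE TORUS T^{(j)}** (p. 416): lattice spacing ε, couplings e, λ, N scalar components, the charge factor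
q…q (T1), and the free propagators *"C^ε_0 for the scalar field and C^ε = (−Δ^ε + μ₀²)^{−1} for the vector field"* AS THE RESOLVENT
KERNELS `resKernel P j ε m²`, `resKernel P j ε μ₀²` — the concrete instance of p26's `SEData`. [cite: Balaban1983Higgs3, (1.22) p.416] -/
def torusSEData (ε e lam : ℝ) (N : ℕ) (q2 msq mu0sq : ℝ) : SEData P j where
  ε := ε
  e := e
  lam := lam
  N := N
  q2 := q2
  C0 := resKernel P j ε msq
  C := resKernel P j ε mu0sq

variable {j}

/-- **print's own lattice**: T_ε = `Site P 0` with ε = L^{−K} = `P.eps` (p. 416: *"We have η = ε (hence L^kε = 1)"*).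
[cite: Balaban1983Higgs3, (1.22) p.416] -/
abbrev printedSEData (e lam : ℝ) (N : ℕ) (q2 msq mu0sq : ℝ) : SEData P 0 := torusSEData P 0 P.eps e lam N q2 msq mu0sq

variable {P}
variable (ε e lam : ℝ) (N : ℕ) (q2 : ℝ) {msq mu0sq : ℝ}

/-- the scalar propagator of the instance is the resolvent at mass m². [cite: Balaban1983Higgs3, (1.22) p.416] -/
@[simp] theorem torusSEData_C0 (msq mu0sq : ℝ) : (torusSEData P j ε e lam N q2 msq mu0sq).C0 = resKernel P j ε msq := rfl

/-- the vector propagator of the instance is the resolvent at mass μ₀². [cite: Balaban1983Higgs3, (1.22) p.416] -/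
@[simp] theorem torusSEData_C (msq mu0sq : ℝ) : (torusSEData P j ε e lam N q2 msq mu0sq).C = resKernel P j ε mu0sq := rfl

/-- the volume element of the instance is ε^d. [cite: Balaban1983Higgs3, (1.23) p.417] -/
@[simp] theorem torusSEData_w (msq mu0sq : ℝ) : (torusSEData P j ε e lam N q2 msq mu0sq).w = ε ^ P.d := rfl

/-- **C^ε_0 = (−Δ^ε + m²)^{−1}** for the instance's scalar propagator, as operators for the ε^d-weighted sums: (−Δ^ε)(C^ε_0f) + m²C^ε_0f = f.
[cite: Balaban1983Higgs3, (1.21) p.416] -/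
theorem torus_C0_green (hε : ε ≠ 0) (hm : 0 < msq) (mu0sq : ℝ) (f : SiteField P j ℝ) :
    laplace ε⁻¹ (kernelOp (ε ^ P.d) (torusSEData P j ε e lam N q2 msq mu0sq).C0 f)
      + msq • kernelOp (ε ^ P.d) (torusSEData P j ε e lam N q2 msq mu0sq).C0 f = f :=
  laplace_kernelOp_resKernel_add hε hm f

/-- **C^ε = (−Δ^ε + μ₀²)^{−1}** for the instance's vector propagator: (−Δ^ε)(C^εf) + μ₀²C^εf = f. [cite: Balaban1983Higgs3, (1.22) p.416] -/
theorem torus_C_green (hε : ε ≠ 0) (msq : ℝ) (hmu : 0 < mu0sq) (f : SiteField P j ℝ) :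
    laplace ε⁻¹ (kernelOp (ε ^ P.d) (torusSEData P j ε e lam N q2 msq mu0sq).C f)
      + mu0sq • kernelOp (ε ^ P.d) (torusSEData P j ε e lam N q2 msq mu0sq).C f = f :=
  laplace_kernelOp_resKernel_add hε hmu f

/-- **C^ε_0 is a function of x − x′** (p26's `ShiftInv`), PROVED for the instance. [cite: Balaban1983Higgs3, (1.22) p.416] -/
theorem shiftInv_torus_C0 (hm : 0 < msq) (mu0sq : ℝ) : ShiftInv (torusSEData P j ε e lam N q2 msq mu0sq).C0 :=
  shiftInv_resKernel ε hm

/-- **C^ε is a function of x − x′**, PROVED for the instance. [cite: Balaban1983Higgs3, (1.22) p.416] -/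
theorem shiftInv_torus_C (msq : ℝ) (hmu : 0 < mu0sq) : ShiftInv (torusSEData P j ε e lam N q2 msq mu0sq).C :=
  shiftInv_resKernel ε hmu

/-- **THE DISPLAYED COUNTERTERMS ①–⑥ OF (1.23) ARE NUMBERS** for the torus propagators — p26's `ct_const` with its two `ShiftInv`
hypotheses DISCHARGED. [cite: Balaban1983Higgs3, (1.23) p.417] -/
theorem torus_ct_const (hm : 0 < msq) (hmu : 0 < mu0sq) (x y : Site P j) :
    ct1 (torusSEData P j ε e lam N q2 msq mu0sq) x = ct1 (torusSEData P j ε e lam N q2 msq mu0sq) y ∧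
    ct2 (torusSEData P j ε e lam N q2 msq mu0sq) x = ct2 (torusSEData P j ε e lam N q2 msq mu0sq) y ∧
    ct3 (torusSEData P j ε e lam N q2 msq mu0sq) x = ct3 (torusSEData P j ε e lam N q2 msq mu0sq) y ∧
    ct4 (torusSEData P j ε e lam N q2 msq mu0sq) x = ct4 (torusSEData P j ε e lam N q2 msq mu0sq) y ∧
    ct5 (torusSEData P j ε e lam N q2 msq mu0sq) x = ct5 (torusSEData P j ε e lam N q2 msq mu0sq) y ∧
    ct6 (torusSEData P j ε e lam N q2 msq mu0sq) x = ct6 (torusSEData P j ε e lam N q2 msq mu0sq) y :=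
  ct_const _ (shiftInv_torus_C0 ε e lam N q2 hm mu0sq) (shiftInv_torus_C ε e lam N q2 msq hmu) x y

/-- **δm²₁ IS A NUMBER** for the torus propagators (p26's `dm2One_const`, hypotheses discharged). [cite: Balaban1983Higgs3, (1.23) p.417] -/
theorem torus_dm2One_const (hm : 0 < msq) (hmu : 0 < mu0sq) (x y : Site P j) :
    dm2One (torusSEData P j ε e lam N q2 msq mu0sq) x = dm2One (torusSEData P j ε e lam N q2 msq mu0sq) y :=
  dm2One_const _ (shiftInv_torus_C0 ε e lam N q2 hm mu0sq) (shiftInv_torus_C ε e lam N q2 msq hmu) x y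

/-- **⑦(δm²₁) AND THE DISPLAYED δm² OF (1.23) ARE NUMBERS** for the torus propagators — *"Thus we have determined the counterterm
δm²"* (p26's `dm2_123_const`, hypotheses discharged). [cite: Balaban1983Higgs3, (1.23) p.417] -/
theorem torus_dm2_123_const (hm : 0 < msq) (hmu : 0 < mu0sq) (x y : Site P j) :
    ct7 (torusSEData P j ε e lam N q2 msq mu0sq) (dm2One (torusSEData P j ε e lam N q2 msq mu0sq)) x =
      ct7 (torusSEData P j ε e lam N q2 msq mu0sq) (dm2One (torusSEData P j ε e lam N q2 msq mu0sq)) y ∧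
    dm2_123 (torusSEData P j ε e lam N q2 msq mu0sq) x = dm2_123 (torusSEData P j ε e lam N q2 msq mu0sq) y :=
  dm2_123_const _ (shiftInv_torus_C0 ε e lam N q2 hm mu0sq) (shiftInv_torus_C ε e lam N q2 msq hmu) x y

/-- **(1.23)① in closed form with THE constant C^ε_0(0)**: δm²_① = −4(N+2)λ·C^ε_0(0), C^ε_0(0) = `diag P j ε m²` (> 0 by `diag_pos`).
[cite: Balaban1983Higgs3, (1.23) p.417] -/
theorem torus_ct1_eq (hε : ε ≠ 0) (hm : 0 < msq) (mu0sq : ℝ) (x : Site P j) :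
    ct1 (torusSEData P j ε e lam N q2 msq mu0sq) x = -4 * ((N : ℝ) + 2) * lam * diag P j ε msq := by
  rw [ct1_eq _ hε, torusSEData_C0, resKernel_diag_eq ε hm]
  rfl

/-- **(1.23)② in closed form with THE constant C^ε(0)**: δm²_② = e²d·C^ε(0)·q², C^ε(0) = `diag P j ε μ₀²`.
[cite: Balaban1983Higgs3, (1.23) p.417] -/
theorem torus_ct2_eq (hε : ε ≠ 0) (msq : ℝ) (hmu : 0 < mu0sq) (x : Site P j) :
    ct2 (torusSEData P j ε e lam N q2 msq mu0sq) x = e ^ 2 * (P.d : ℝ) * diag P j ε mu0sq * q2 := by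
  rw [ct2_eq _ hε, torusSEData_C, resKernel_diag_eq ε hmu]
  rfl

/-- **(1.23)③ in closed form**: δm²_③ = (2·3/4!)de⁴ε²(C^ε(0))²q⁴. [cite: Balaban1983Higgs3, (1.23) p.417] -/
theorem torus_ct3_eq (hε : ε ≠ 0) (msq : ℝ) (hmu : 0 < mu0sq) (x : Site P j) :
    ct3 (torusSEData P j ε e lam N q2 msq mu0sq) x =
      (2 * 3 : ℝ) / (Nat.factorial 4 : ℕ) * (P.d : ℝ) * e ^ 4 * ε ^ 2 * (diag P j ε mu0sq) ^ 2 * q2 ^ 2 := by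
  rw [ct3_eq _ hε, torusSEData_C, resKernel_diag_eq ε hmu]
  rfl

/-- **the two constants are positive** (ε > 0): C^ε_0(0) > 0 and C^ε(0) > 0 — in particular ① < 0 < ② for λ, e, q² > 0, as the signs
printed in (1.23). [cite: Balaban1983Higgs3, (1.23) p.417] -/
theorem torus_diag_pos (hε : 0 < ε) (hm : 0 < msq) (hmu : 0 < mu0sq) :
    0 < diag P j ε msq ∧ 0 < diag P j ε mu0sq :=
  ⟨diag_pos hε hm, diag_pos hε hmu⟩

/-- the propagators of the instance are nonnegative and symmetric kernels. [cite: Balaban1983Higgs3, (1.22) p.416] -/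
theorem torus_propagators_nonneg_symm (hε : 0 < ε) (hm : 0 < msq) (hmu : 0 < mu0sq) (x x' : Site P j) :
    0 ≤ (torusSEData P j ε e lam N q2 msq mu0sq).C0 x x' ∧ 0 ≤ (torusSEData P j ε e lam N q2 msq mu0sq).C x x' ∧
    (torusSEData P j ε e lam N q2 msq mu0sq).C0 x x' = (torusSEData P j ε e lam N q2 msq mu0sq).C0 x' x ∧
    (torusSEData P j ε e lam N q2 msq mu0sq).C x x' = (torusSEData P j ε e lam N q2 msq mu0sq).C x' x :=
  ⟨resKernel_nonneg hε hm x x', resKernel_nonneg hε hmu x x', resKernel_symm ε msq x x', resKernel_symm ε mu0sq x x'⟩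

end Instance

end

end Literature.MathematicalPhysics.QuantumFieldTheory.Balaban1983to89.B3Eq122TorusPropagators
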